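import Summits.CriticalPhenomena.PercolationContinuityZ3.Theorems.PercNearOneGluingNoHeavyPcintMemoryFourRecursion
import HarnessLib

/-!
# CriticalPhenomena/PercolationContinuityZ3 — Theorems/PercNearOneGluingNoHeavyPcintClosingHexagons.lean: the closing 5-step self-avoiding words — seven explicit families, `2·6·p_6(ℤ^d) ≥ 12d(d−1) + 32d(d−1)(d−2) = 4d(d−1)(8d−13)`

Lane prim-pcint, STRUCTURE rule.  `closingCount d 6 = #nearWords d 6 5` (…PcintLoopExclusionLaw) is the number of 5-step
self-avoiding words ending next to their start, `2·6·p_6(ℤ^d)`, the numerator of the second-rung density `f_6` of the typed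
law C4.  Writing a closing word in first-appearance normal form (`x` = first step, `y` = first step off the axis of `x`, `z` =
first step off both axes) there are exactly SEVEN shapes (seat numerics, brute force d = 2, 3, 4: 24, 264, 912 words):
three-axis `x y x⁻ z y⁻`, `x y z x⁻ y⁻`, `x y z x⁻ z⁻`, `x y z y⁻ x⁻` (the hexagons on three axes; `2d(2d−2)(2d−4)` words each) and
two-axis `x x y x⁻ x⁻`, `x y x⁻ x⁻ y⁻`, `x y y x⁻ y⁻` (the `1 × 2` rectangles; `2d(2d−2)` each).  This file proves the LOWER
bound by seven injective families with pairwise distinct images (distinguished by a decision tree on the letters):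
**`closingCount_six_ge : 4·(2d)(2d−2)(2d−4) + 3·(2d)(2d−2) ≤ closingCount d 6`** (`= 264` on `ℤ³`; equality holds but is not
needed: lower bounds on `f_6` are what upper bounds on `R_6 = Δ_6/f_6` consume, …PcintMemCertZ3T6 / …RungSixZ3).

HONEST FRAMING: elementary combinatorics; nothing here is used by a certified `p_c` cell.  Written by prim-pcint-2 gen 17
(prover-prim-pcint-2-g17-0), 2026-08-25.
-/

noncomputable section

open Filter Topology Matrix
open Literature.Probability.LatticeModels Literature.Probability.Percolation
open Summit.CriticalPhenomena.PercolationContinuityZ3.Theorems.Pcint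

namespace Summit.CriticalPhenomena.PercolationContinuityZ3.Theorems.Pcint.MemoryTail

variable {d : ℕ}

/-! ### Non-vanishing sums of unit steps -/

/-- `e_a + e_b ≠ 0` for steps on different axes. [folklore] -/
theorem stepVec_add_ne_zero {a b : Fin d × Bool} (h : a.1 ≠ b.1) : stepVec a + stepVec b ≠ 0 := by
  intro e
  have := congrFun e a.1
  simp only [Pi.add_apply, Pi.zero_apply, stepVec_apply, if_true, if_neg h] at this
  cases ha : a.2 <;> simp [ha] at this

/-- `e_a − e_b ≠ 0` for steps on different axes. [folklore] -/
theorem stepVec_add_neg_ne_zero {a b : Fin d × Bool} (h : a.1 ≠ b.1) : stepVec a + -stepVec b ≠ 0 := by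
  intro e
  have := congrFun e a.1
  simp only [Pi.add_apply, Pi.neg_apply, Pi.zero_apply, stepVec_apply, if_true, if_neg h] at this
  cases ha : a.2 <;> simp [ha] at this

/-- `−e_a + e_b ≠ 0` for steps on different axes. [folklore] -/
theorem neg_stepVec_add_ne_zero {a b : Fin d × Bool} (h : a.1 ≠ b.1) : -stepVec a + stepVec b ≠ 0 := by
  rw [add_comm]; exact stepVec_add_neg_ne_zero (Ne.symm h)

/-- `−e_a − e_b ≠ 0` for steps on different axes. [folklore] -/
theorem neg_stepVec_add_neg_ne_zero {a b : Fin d × Bool} (h : a.1 ≠ b.1) : -stepVec a + -stepVec b ≠ 0 := by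
  rw [← neg_add, neg_ne_zero]; exact stepVec_add_ne_zero h

/-- `2 e_a ≠ 0`. [folklore] -/
theorem stepVec_add_self_ne_zero (a : Fin d × Bool) : stepVec a + stepVec a ≠ 0 := by
  intro e
  have := congrFun e a.1
  simp only [Pi.add_apply, Pi.zero_apply, stepVec_apply, if_true] at this
  cases ha : a.2 <;> simp [ha] at this

/-- `−2 e_a ≠ 0`. [folklore] -/
theorem neg_stepVec_add_neg_self_ne_zero (a : Fin d × Bool) : -stepVec a + -stepVec a ≠ 0 := by
  rw [← neg_add, neg_ne_zero]; exact stepVec_add_self_ne_zero a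

/-! ### Five-letter words: positions and a self-avoidance criterion -/

/-- The positions of the word `a b c e f`. [folklore] -/
theorem wordPos_vec5 (a b c e f : Fin d × Bool) :
    wordPos ![a, b, c, e, f] 1 = stepVec a ∧ wordPos ![a, b, c, e, f] 2 = stepVec a + stepVec b ∧
    wordPos ![a, b, c, e, f] 3 = stepVec a + stepVec b + stepVec c ∧
    wordPos ![a, b, c, e, f] 4 = stepVec a + stepVec b + stepVec c + stepVec e ∧
    wordPos ![a, b, c, e, f] 5 = stepVec a + stepVec b + stepVec c + stepVec e + stepVec f := by
  set w : Fin 5 → Fin d × Bool := ![a, b, c, e, f] with hw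
  have p1 : wordPos w 1 = stepVec a := by
    have h := wordPos_succ w (k := 0) (by omega); simp only [wordPos_zero, zero_add] at h; exact h
  have p2 : wordPos w 2 = stepVec a + stepVec b := by
    have h := wordPos_succ w (k := 1) (by omega); rw [p1] at h; exact h
  have p3 : wordPos w 3 = stepVec a + stepVec b + stepVec c := by
    have h := wordPos_succ w (k := 2) (by omega); rw [p2] at h; exact h
  have p4 : wordPos w 4 = stepVec a + stepVec b + stepVec c + stepVec e := by
    have h := wordPos_succ w (k := 3) (by omega); rw [p3] at h; exact h
  have p5 : wordPos w 5 = stepVec a + stepVec b + stepVec c + stepVec e + stepVec f := by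
    have h := wordPos_succ w (k := 4) (by omega); rw [p4] at h; exact h
  exact ⟨p1, p2, p3, p4, p5⟩

/-- **Self-avoidance of a five-letter word from its even-gap sums**: sites an odd number of steps apart never coincide
(parity), so it suffices that the sums of 2 consecutive steps and of 4 consecutive steps do not vanish. [folklore] -/
theorem isSAW_vec5 (a b c e f : Fin d × Bool) (g01 : stepVec a + stepVec b ≠ 0) (g12 : stepVec b + stepVec c ≠ 0)
    (g23 : stepVec c + stepVec e ≠ 0) (g34 : stepVec e + stepVec f ≠ 0)
    (g03 : stepVec a + stepVec b + stepVec c + stepVec e ≠ 0) (g14 : stepVec b + stepVec c + stepVec e + stepVec f ≠ 0) :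
    IsSAW ![a, b, c, e, f] := by
  obtain ⟨p1, p2, p3, p4, p5⟩ := wordPos_vec5 a b c e f
  set w : Fin 5 → Fin d × Bool := ![a, b, c, e, f] with hw
  have h02 : wordPos w 2 ≠ wordPos w 0 := by rw [p2, wordPos_zero]; exact g01
  have h13 : wordPos w 3 ≠ wordPos w 1 := fun h => g12 (by rw [p3, p1] at h; linear_combination h)
  have h24 : wordPos w 4 ≠ wordPos w 2 := fun h => g23 (by rw [p4, p2] at h; linear_combination h)
  have h35 : wordPos w 5 ≠ wordPos w 3 := fun h => g34 (by rw [p5, p3] at h; linear_combination h)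
  have h04 : wordPos w 4 ≠ wordPos w 0 := by rw [p4, wordPos_zero]; exact g03
  have h15 : wordPos w 5 ≠ wordPos w 1 := fun h => g14 (by rw [p5, p1] at h; linear_combination h)
  intro i j hi hj hij
  by_contra hne
  rcases Nat.lt_or_gt_of_ne hne with hlt | hgt
  · have hpar : (i + j) % 2 = 0 := by
      by_contra hodd
      exact wordPos_ne_of_odd w hi hj (by omega) hij
    rcases (show (i = 0 ∧ j = 2) ∨ (i = 1 ∧ j = 3) ∨ (i = 2 ∧ j = 4) ∨ (i = 3 ∧ j = 5) ∨ (i = 0 ∧ j = 4) ∨ (i = 1 ∧ j = 5)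
      by omega) with ⟨rfl, rfl⟩ | ⟨rfl, rfl⟩ | ⟨rfl, rfl⟩ | ⟨rfl, rfl⟩ | ⟨rfl, rfl⟩ | ⟨rfl, rfl⟩
    · exact h02 hij.symm
    · exact h13 hij.symm
    · exact h24 hij.symm
    · exact h35 hij.symm
    · exact h04 hij.symm
    · exact h15 hij.symm
  · have hpar : (i + j) % 2 = 0 := by
      by_contra hodd
      exact wordPos_ne_of_odd w hi hj (by omega) hij
    rcases (show (j = 0 ∧ i = 2) ∨ (j = 1 ∧ i = 3) ∨ (j = 2 ∧ i = 4) ∨ (j = 3 ∧ i = 5) ∨ (j = 0 ∧ i = 4) ∨ (j = 1 ∧ i = 5)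
      by omega) with ⟨rfl, rfl⟩ | ⟨rfl, rfl⟩ | ⟨rfl, rfl⟩ | ⟨rfl, rfl⟩ | ⟨rfl, rfl⟩ | ⟨rfl, rfl⟩
    · exact h02 hij
    · exact h13 hij
    · exact h24 hij
    · exact h35 hij
    · exact h04 hij
    · exact h15 hij

/-- A five-letter self-avoiding word whose letters sum to a unit vector is a closing word (`∈ nearWords d 6 5`). [folklore] -/
theorem mem_nearWords_six_of (a b c e f u : Fin d × Bool) (hs : IsSAW ![a, b, c, e, f])
    (hsum : stepVec a + stepVec b + stepVec c + stepVec e + stepVec f = stepVec u) : ![a, b, c, e, f] ∈ nearWords d 6 5 := by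
  classical
  unfold nearWords
  rw [Finset.mem_filter, mem_sawWords]
  refine ⟨hs, ?_⟩
  rw [(wordPos_vec5 a b c e f).2.2.2.2, hsum, l1_stepVec]

/-! ### The seven families -/

/-- The shape classifier of a five-letter word (first-appearance decision tree; values `0..6` name the shapes
`x x y x⁻ x⁻`, `x y y x⁻ y⁻`, `x y x⁻ x⁻ y⁻`, `x y x⁻ z y⁻`, `x y z y⁻ x⁻`, `x y z x⁻ y⁻`, `x y z x⁻ z⁻`). [folklore] -/
def shape5 (w : Fin 5 → Fin d × Bool) : Fin 7 :=
  if w 1 = w 0 then 0 else if w 2 = w 1 then 1 else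
  if w 2 = srev (w 0) then (if w 3 = srev (w 0) then 2 else 3) else
  if w 3 = srev (w 1) then 4 else if w 4 = srev (w 1) then 5 else 6

/-- The parameter set of the three-axis families: ordered triples of steps on pairwise different axes. [folklore] -/
def triples (d : ℕ) : Finset (Σ _ : Fin d × Bool, Σ _ : Fin d × Bool, Fin d × Bool) :=
  (Finset.univ : Finset (Fin d × Bool)).sigma fun x =>
    ((Finset.univ : Finset (Fin d × Bool)).filter fun y => y.1 ≠ x.1).sigma fun y =>
      (Finset.univ : Finset (Fin d × Bool)).filter fun z => z.1 ≠ x.1 ∧ z.1 ≠ y.1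

/-- The parameter set of the two-axis families: ordered pairs of steps on different axes. [folklore] -/
def pairs (d : ℕ) : Finset (Σ _ : Fin d × Bool, Fin d × Bool) :=
  (Finset.univ : Finset (Fin d × Bool)).sigma fun x => (Finset.univ : Finset (Fin d × Bool)).filter fun y => y.1 ≠ x.1

/-- The steps off two different axes number `2d − 4`. [folklore] -/
theorem card_filter_fst_ne_ne {i j : Fin d} (hij : i ≠ j) :
    ((Finset.univ : Finset (Fin d × Bool)).filter fun a => a.1 ≠ i ∧ a.1 ≠ j).card = 2 * d - 4 := by
  classical
  have : ((Finset.univ : Finset (Fin d × Bool)).filter fun a => a.1 ≠ i ∧ a.1 ≠ j) =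
      ((Finset.univ.erase i).erase j) ×ˢ (Finset.univ : Finset Bool) := by
    ext ⟨k, b⟩
    simp only [Finset.mem_filter, Finset.mem_univ, true_and, Finset.mem_product, Finset.mem_erase, and_true]
    tauto
  rw [this, Finset.card_product, Finset.card_erase_of_mem (Finset.mem_erase.2 ⟨hij.symm, Finset.mem_univ _⟩),
    Finset.card_erase_of_mem (Finset.mem_univ _), Finset.card_univ, Fintype.card_fin, Finset.card_univ, Fintype.card_bool]
  omega

/-- `#triples = 2d(2d−2)(2d−4)`. [folklore] -/
theorem card_triples (d : ℕ) : (triples d).card = 2 * d * (2 * d - 2) * (2 * d - 4) := by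
  classical
  unfold triples
  rw [Finset.card_sigma]
  have hin : ∀ x : Fin d × Bool, (((Finset.univ : Finset (Fin d × Bool)).filter fun y => y.1 ≠ x.1).sigma fun y =>
      (Finset.univ : Finset (Fin d × Bool)).filter fun z => z.1 ≠ x.1 ∧ z.1 ≠ y.1).card = (2 * d - 2) * (2 * d - 4) := by
    intro x
    rw [Finset.card_sigma]
    have : ∀ y ∈ (Finset.univ : Finset (Fin d × Bool)).filter (fun y => y.1 ≠ x.1),
        ((Finset.univ : Finset (Fin d × Bool)).filter fun z => z.1 ≠ x.1 ∧ z.1 ≠ y.1).card = 2 * d - 4 := by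
      intro y hy
      rw [Finset.mem_filter] at hy
      exact card_filter_fst_ne_ne (Ne.symm hy.2)
    rw [Finset.sum_congr rfl this, Finset.sum_const, card_filter_fst_ne', smul_eq_mul]
  simp_rw [hin, Finset.sum_const, Finset.card_univ, Fintype.card_prod, Fintype.card_fin, Fintype.card_bool, smul_eq_mul]
  ring

/-- `#pairs = 2d(2d−2)`. [folklore] -/
theorem card_pairs (d : ℕ) : (pairs d).card = 2 * d * (2 * d - 2) := by
  classical
  unfold pairs
  rw [Finset.card_sigma]
  simp_rw [card_filter_fst_ne', Finset.sum_const, Finset.card_univ, Fintype.card_prod, Fintype.card_fin, Fintype.card_bool,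
    smul_eq_mul]
  ring

/-- The seven family maps. [folklore] -/
def fam (k : Fin 7) (x y z : Fin d × Bool) : Fin 5 → Fin d × Bool :=
  match k with
  | 0 => ![x, x, y, srev x, srev x]
  | 1 => ![x, y, y, srev x, srev y]
  | 2 => ![x, y, srev x, srev x, srev y]
  | 3 => ![x, y, srev x, z, srev y]
  | 4 => ![x, y, z, srev y, srev x]
  | 5 => ![x, y, z, srev x, srev y]
  | 6 => ![x, y, z, srev x, srev z]

/-- **The two-axis family members are closing self-avoiding words of their own shapes** (`y` off the axis of `x`; `z` is
not used by these shapes). [folklore] -/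
theorem fam_two_axis (k : Fin 7) (hk : k.val < 3) {x y : Fin d × Bool} (z : Fin d × Bool) (hyx : y.1 ≠ x.1) :
    fam k x y z ∈ nearWords d 6 5 ∧ shape5 (fam k x y z) = k := by
  have hxy : x.1 ≠ y.1 := Ne.symm hyx
  have nyx : y ≠ x := fun e => hyx (by rw [e])
  have nsxy : srev x ≠ y := fun e => hyx (by rw [← e]; rfl)
  fin_cases k <;> simp at hk
  · -- 0: x x y x⁻ x⁻, end y
    refine ⟨mem_nearWords_six_of x x y (srev x) (srev x) y ?_ (by simp only [stepVec_srev]; abel), ?_⟩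
    · refine isSAW_vec5 _ _ _ _ _ (stepVec_add_self_ne_zero x) (stepVec_add_ne_zero hxy) ?_ ?_ ?_ ?_
      · simp only [stepVec_srev]; exact stepVec_add_neg_ne_zero hyx
      · simp only [stepVec_srev]; exact neg_stepVec_add_neg_self_ne_zero x
      · simp only [stepVec_srev]; exact fun e => stepVec_add_ne_zero hxy (by linear_combination e)
      · simp only [stepVec_srev]; exact fun e => stepVec_add_neg_ne_zero hyx (by linear_combination e)
    · simp [fam, shape5]
  · -- 1: x y y x⁻ y⁻, end y
    refine ⟨mem_nearWords_six_of x y y (srev x) (srev y) y ?_ (by simp only [stepVec_srev]; abel), ?_⟩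
    · refine isSAW_vec5 _ _ _ _ _ (stepVec_add_ne_zero hxy) (stepVec_add_self_ne_zero y) ?_ ?_ ?_ ?_
      · simp only [stepVec_srev]; exact stepVec_add_neg_ne_zero hyx
      · simp only [stepVec_srev]; exact neg_stepVec_add_neg_ne_zero hxy
      · simp only [stepVec_srev]; exact fun e => stepVec_add_self_ne_zero y (by linear_combination e)
      · simp only [stepVec_srev]; exact fun e => stepVec_add_neg_ne_zero hyx (by linear_combination e)
    · simp [fam, shape5, nyx]
  · -- 2: x y x⁻ x⁻ y⁻, end x⁻
    refine ⟨mem_nearWords_six_of x y (srev x) (srev x) (srev y) (srev x) ?_ (by simp only [stepVec_srev]; abel), ?_⟩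
    · refine isSAW_vec5 _ _ _ _ _ (stepVec_add_ne_zero hxy) ?_ ?_ ?_ ?_ ?_
      · simp only [stepVec_srev]; exact stepVec_add_neg_ne_zero hyx
      · simp only [stepVec_srev]; exact neg_stepVec_add_neg_self_ne_zero x
      · simp only [stepVec_srev]; exact neg_stepVec_add_neg_ne_zero hxy
      · simp only [stepVec_srev]; exact fun e => stepVec_add_neg_ne_zero hyx (by linear_combination e)
      · simp only [stepVec_srev]
        exact fun e => neg_stepVec_add_neg_self_ne_zero x (by linear_combination e)
    · simp [fam, shape5, nyx, nsxy]

/-- **The three-axis family members are closing self-avoiding words of their own shapes** (`x, y, z` on pairwise different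
axes). [folklore] -/
theorem fam_three_axis (k : Fin 7) (hk : 3 ≤ k.val) {x y z : Fin d × Bool} (hyx : y.1 ≠ x.1) (hzx : z.1 ≠ x.1)
    (hzy : z.1 ≠ y.1) : fam k x y z ∈ nearWords d 6 5 ∧ shape5 (fam k x y z) = k := by
  have hxy : x.1 ≠ y.1 := Ne.symm hyx
  have hxz : x.1 ≠ z.1 := Ne.symm hzx
  have hyz : y.1 ≠ z.1 := Ne.symm hzy
  have nyx : y ≠ x := fun e => hyx (by rw [e])
  have nzy : z ≠ y := fun e => hzy (by rw [e])
  have nzsx : z ≠ srev x := fun e => hzx (by rw [e]; rfl)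
  have nsxy : srev x ≠ y := fun e => hyx (by rw [← e]; rfl)
  have nsxsy : srev x ≠ srev y := fun e => hxy (congrArg Prod.fst (srev_injective e))
  have nszsy : srev z ≠ srev y := fun e => hzy (congrArg Prod.fst (srev_injective e))
  fin_cases k <;> simp at hk
  · -- 3: x y x⁻ z y⁻, end z
    refine ⟨mem_nearWords_six_of x y (srev x) z (srev y) z ?_ (by simp only [stepVec_srev]; abel), ?_⟩
    · refine isSAW_vec5 _ _ _ _ _ (stepVec_add_ne_zero hxy) ?_ ?_ ?_ ?_ ?_
      · simp only [stepVec_srev]; exact stepVec_add_neg_ne_zero hyx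
      · simp only [stepVec_srev]; exact neg_stepVec_add_ne_zero hxz
      · simp only [stepVec_srev]; exact stepVec_add_neg_ne_zero hzy
      · simp only [stepVec_srev]; exact fun e => stepVec_add_ne_zero hyz (by linear_combination e)
      · simp only [stepVec_srev]; exact fun e => neg_stepVec_add_ne_zero hxz (by linear_combination e)
    · simp [fam, shape5, nyx, nsxy, nzsx]
  · -- 4: x y z y⁻ x⁻, end z
    refine ⟨mem_nearWords_six_of x y z (srev y) (srev x) z ?_ (by simp only [stepVec_srev]; abel), ?_⟩
    · refine isSAW_vec5 _ _ _ _ _ (stepVec_add_ne_zero hxy) (stepVec_add_ne_zero hyz) ?_ ?_ ?_ ?_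
      · simp only [stepVec_srev]; exact stepVec_add_neg_ne_zero hzy
      · simp only [stepVec_srev]; exact neg_stepVec_add_neg_ne_zero hyx
      · simp only [stepVec_srev]; exact fun e => stepVec_add_ne_zero hxz (by linear_combination e)
      · simp only [stepVec_srev]; exact fun e => stepVec_add_neg_ne_zero hzx (by linear_combination e)
    · simp [fam, shape5, nyx, nzy, nzsx]
  · -- 5: x y z x⁻ y⁻, end z
    refine ⟨mem_nearWords_six_of x y z (srev x) (srev y) z ?_ (by simp only [stepVec_srev]; abel), ?_⟩
    · refine isSAW_vec5 _ _ _ _ _ (stepVec_add_ne_zero hxy) (stepVec_add_ne_zero hyz) ?_ ?_ ?_ ?_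
      · simp only [stepVec_srev]; exact stepVec_add_neg_ne_zero hzx
      · simp only [stepVec_srev]; exact neg_stepVec_add_neg_ne_zero hxy
      · simp only [stepVec_srev]; exact fun e => stepVec_add_ne_zero hyz (by linear_combination e)
      · simp only [stepVec_srev]; exact fun e => stepVec_add_neg_ne_zero hzx (by linear_combination e)
    · simp [fam, shape5, nyx, nzy, nzsx, nsxsy]
  · -- 6: x y z x⁻ z⁻, end y
    refine ⟨mem_nearWords_six_of x y z (srev x) (srev z) y ?_ (by simp only [stepVec_srev]; abel), ?_⟩
    · refine isSAW_vec5 _ _ _ _ _ (stepVec_add_ne_zero hxy) (stepVec_add_ne_zero hyz) ?_ ?_ ?_ ?_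
      · simp only [stepVec_srev]; exact stepVec_add_neg_ne_zero hzx
      · simp only [stepVec_srev]; exact neg_stepVec_add_neg_ne_zero hxz
      · simp only [stepVec_srev]; exact fun e => stepVec_add_ne_zero hyz (by linear_combination e)
      · simp only [stepVec_srev]; exact fun e => stepVec_add_neg_ne_zero hyx (by linear_combination e)
    · simp [fam, shape5, nyx, nzy, nzsx, nsxsy, nszsy]

/-- The family maps determine `x, y` (letters `0, 1`), and `z` for the three-axis shapes (letter `2` or `3`). [folklore] -/
theorem fam_inj (k : Fin 7) {x y z x' y' z' : Fin d × Bool} (h : fam k x y z = fam k x' y' z') :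
    x = x' ∧ y = y' ∧ (3 ≤ k.val → z = z') := by
  have e0 := congrFun h 0
  have e1 := congrFun h 1
  have e2 := congrFun h 2
  have e3 := congrFun h 3
  fin_cases k <;> simp [fam] at e0 e1 e2 e3 ⊢ <;> tauto

/-! ### The count -/

/-- **`2·6·p_6(ℤ^d) ≥ 4·(2d)(2d−2)(2d−4) + 3·(2d)(2d−2) = 4d(d−1)(8d−13)`** (`= 264` on `ℤ³`, `912` on `ℤ⁴`). [folklore] -/
theorem closingCount_six_ge : 4 * (2 * d * (2 * d - 2) * (2 * d - 4)) + 3 * (2 * d * (2 * d - 2)) ≤ closingCount d 6 := by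
  classical
  unfold closingCount
  rw [show (6 : ℕ) - 1 = 5 from rfl, ← card_triples d, ← card_pairs d]
  set N := nearWords d 6 5 with hN
  have hfib : N.card = ∑ k : Fin 7, (N.filter fun w => shape5 w = k).card :=
    Finset.card_eq_sum_card_fiberwise (fun w _ => Finset.mem_univ (shape5 w))
  have h3 : ∀ k : Fin 7, 3 ≤ k.val → (triples d).card ≤ (N.filter fun w => shape5 w = k).card := by
    intro k hk
    refine Finset.card_le_card_of_injOn (fun t => fam k t.1 t.2.1 t.2.2) (fun t ht => ?_) (fun t ht t' ht' h => ?_)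
    · rw [Finset.mem_coe, triples, Finset.mem_sigma, Finset.mem_sigma, Finset.mem_filter, Finset.mem_filter] at ht
      obtain ⟨-, ⟨-, hyx⟩, -, hzx, hzy⟩ := ht
      rw [Finset.mem_coe, Finset.mem_filter]
      exact fam_three_axis k hk hyx hzx hzy
    · obtain ⟨x, y, z⟩ := t
      obtain ⟨x', y', z'⟩ := t'
      obtain ⟨rfl, rfl, hz⟩ := fam_inj k h
      obtain rfl := hz hk
      rfl
  have h2 : ∀ k : Fin 7, k.val < 3 → (pairs d).card ≤ (N.filter fun w => shape5 w = k).card := by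
    intro k hk
    refine Finset.card_le_card_of_injOn (fun t => fam k t.1 t.2 t.2) (fun t ht => ?_) (fun t ht t' ht' h => ?_)
    · rw [Finset.mem_coe, pairs, Finset.mem_sigma, Finset.mem_filter] at ht
      obtain ⟨-, -, hyx⟩ := ht
      rw [Finset.mem_coe, Finset.mem_filter]
      exact fam_two_axis k hk _ hyx
    · obtain ⟨x, y⟩ := t
      obtain ⟨x', y'⟩ := t'
      obtain ⟨rfl, rfl, -⟩ := fam_inj k h
      rfl
  have a0 := h2 0 (by decide)
  have a1 := h2 1 (by decide)
  have a2 := h2 2 (by decide)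
  have a3 := h3 3 (by decide)
  have a4 := h3 4 (by decide)
  have a5 := h3 5 (by decide)
  have a6 := h3 6 (by decide)
  rw [hfib, Fin.sum_univ_seven]
  omega

end Summit.CriticalPhenomena.PercolationContinuityZ3.Theorems.Pcint.MemoryTail
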